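/-
Copyright (c) 2026 the pub-hodgecm-mathlib formalisation cell (harness21).  Prover seat hodgecm-mathlib-K2E1-p12 (g2), Track B ∕ K2-LIT, h413 =
`stmt-HodgeConjecture-24833`, line `K2_E1_TraceFormulaBeta`, (137)∕P4 «N = 2 RES-chain print», part 1b — the χ-EDITION of ★ p859977 `K2E1ContinuedEisensteinResidueFunctionUTwo` §2–§3
(dealer K2E1-plan (g7) (182)∕(203), 2026-09-04): SHAPE-FREE constant term, GENERAL pole.
-/
import Summits.HodgeConjecture.HodgeConjecture.Theorems.K2E1ContinuedEisensteinResidueFunctionUTwo   -- THIS SEAT ★ p859977 (part 1): the scalar-shape heads; brings ★ `truncation_rational_mul`, ★ HighCuspTwo, ★ R6e, the BL spaces, `supHeight_eq_ciSup_arithmetic`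
import HarnessLib

/-!
# K2·E1 — `K2E1ContinuedEisensteinResidueShapeFreeUTwo` ((137)∕P4, part 1b, `U(J₂)_{E/F}`): THE SIEGEL-TOP FORMULA AND THE RESIDUE IDENTIFICATION OF `Λ^T Ẽ(z)` FOR A SHAPE-FREE CONSTANT
# TERM AND A GENERAL POLE `ρ₀` — the χ-edition of ★ p859977 §2–§3

Track B ∕ K2-LIT, crux h413 = `stmt-HodgeConjecture-24833`, route of record `HCCMUnconditional`; cell `hodgecm-mathlib`, squad K2, ENGINE E1.  Prover seat `hodgecm-mathlib-K2E1-p12` (g2);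
dealer K2E1-plan (g7) (182) «where the proof is blind to χ, state the residue-function file for a general continued family (letters) so the sd-χ families reuse it» and (203) «the
χ-edition of FILE 1 §2–§3 (left-`B(F)N(𝔸)`-invariant CT in place of `Φ∘H`) YES».  Filed as its own module (★ part 1 is at the 400-line cap).  THEOREMS ONLY (no `def`, no `instance`, no
notation, no named-fact hypothesis, no `sorry`); lane `--supports stmt-HodgeConjecture-24833 --as helper` (count-neutral).  Closes no socket.  Generic `F E c`, `U(J₂)`.

THE MATHEMATICS ([MoeglinWaldspurger1995, IV.1.11, I.2.13]; [Langlands1976, §7]).  ★ part 1 §1 (`continuous_residueValue`, the uniform bound near the pole, `G(F)`-invariance) never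
mentions the constant term and is reusable by every continued family as it stands.  ★ part 1 §2–§3 use the SCALAR spherical shape (E3′)₂ `Ẽ(z)_B = φ₀(H^z + c̃(z)H^{1−z})` and the
pole `1`; for a self-dual χ-family `E(z, f ⊗ φ_χ)` the constant term `φ_z + (M(z)φ)_{1−z}` is a left-`B(F)N(𝔸)`-invariant function of `g`, not of `H(g)` alone, and for `η`-type χ the
(finitely many, Maass–Selberg) poles need not sit at `1`.  This module restates §2–§3 with NO shape at all:
* **`truncation_apply_of_forall_borelHeight_le`** — `Λ^T u(y) = u(y) − 𝟙[T < H(γ₀y)]·u_B(γ₀y)` for `T ≥ 1`, `u` left-`G(F)`-invariant, and ANY maximiser `γ₀` of `γ ↦ H(γy)` (★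
  `exists_forall_borelHeight_mul_le` supplies one); `ciSup_borelHeight_eq_of_forall_le` — `H(γ₀y) = w(y)`.
* **`tendsto_sub_mul_truncation_continued_of_forall_borelHeight_le`** — under the ONE letter `hCTres : (z−ρ₀)·Ẽ(z)_B(g) → Rct(g)` (the constant term has at most a simple pole at `ρ₀`
  with residue function `Rct`) and the pole letter (F) at `ρ₀`: `(z−ρ₀)·Λ^T Ẽ(z)(y) → F y ρ₀ − 𝟙[T < H(γ₀y)]·Rct(γ₀y)`.
* **`ae_residue_eq_residueValue_sub_of_forall_borelHeight_le`** — `Res_T(x) = F g̃⁻¹ ρ₀ − 𝟙[T < w₁(x)]·Rct(γ₀ g̃⁻¹)` for `μ`-a.e. `x = [g]` and every maximiser `γ₀`, whenever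
  `F_T(z) =ᵐ Λ^T Ẽ(z)` on `D` and `(z−ρ₀)•F_T(z) → Res_T` in `L²(μ)`.
The scalar heads of ★ part 1 are the instance `ρ₀ = 1`, `Rct ≡ φ₀r`.
HONEST LABEL: HC_CM is proved only modulo the 7 printed citations (2 remaining named inputs: hLiu418 = `stmt-HodgeConjecture-24832`, h413 = `stmt-HodgeConjecture-24833`) until rung 0
closes; this file asserts no named fact and closes no socket; its heads are CONDITIONAL on the visible letters `hEcinv`, `hCTres`, (F) `hF hFE`, and (`hFam`, `hRes`).
References: [MoeglinWaldspurger1995] I.2.13, IV.1.11 · [Langlands1976] §7 · [BernsteinLapid2019] §4 p. 10 · [Garrett2018] §2.10–§2.11.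
-/

set_option autoImplicit false
-- the mandated namespace repeats the single-problem summit's segment (`HodgeConjecture.HodgeConjecture`)
set_option linter.dupNamespace false

noncomputable section

open MeasureTheory Measure NumberField IsDedekindDomain Set Filter Topology Metric
open scoped ENNReal NNReal
open Literature.NumberTheory.Automorphic Literature.NumberTheory.Automorphic.UnitaryGroup AdelicGroupData
open Summit.HodgeConjecture.HodgeConjecture.Cruxes.H413.K2E1BLBorelSpacesU2Defs
open Summit.HodgeConjecture.HodgeConjecture.Cruxes.H413.K2E1BLEisensteinInWeightedSpaceU2Weights (supHeight_eq_ciSup_arithmetic)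
open Summit.HodgeConjecture.HodgeConjecture.Cruxes.H413.K2E1BLHeckeOperatorWeightedU2 (bddAbove_range_borelHeight_arith_mul)
open Summit.HodgeConjecture.HodgeConjecture.Cruxes.H413.K2E1TruncatedEisensteinL2 (truncation_apply_eq_self_of_forall_borelHeight_le)

namespace Summit.HodgeConjecture.HodgeConjecture.Cruxes.H413.K2E1ContinuedEisensteinResidueShapeFreeUTwo

/-! ## The χ-edition: SHAPE-FREE constant term and a GENERAL pole `ρ₀`

For the self-dual χ-families (ROADCARD «5Res ENDGAME BY FAMILIES» §1 (SD); consumers: K2E1-p15's (ii) letter `hne`, the residue bookkeeping of C9) the constant term of the continued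
family is NOT a function of the height alone (`CT(E(z,f⊗φ_χ))(g) = φ_z(g) + (M(z)φ)_{1−z}(g)` is a left-`B(F)N(𝔸)`-invariant function of `g`) and the pole may sit at any `ρ₀`.  The
Siegel-top formula and the two limit statements of ★ part 1 §2–§3 hold verbatim with (i) the top constant term `u_B(γ₀y)` at ANY maximiser `γ₀` of `γ ↦ H(γy)` in place of `Φ(w(y))` (★ the
maximiser exists, `K2E1BLHeightCosetsU2.exists_forall_borelHeight_mul_le`), and (ii) the single RESIDUE-OF-THE-CONSTANT-TERM letter `(z−ρ₀)·Ẽ(z)_B(g) → Rct(g)` in place of the scalar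
shape (E3′)₂ — no `Φ ∘ H`, no `φ₀`, no `c̃`.  The scalar heads of ★ part 1 §2–§3 are the instance `ρ₀ = 1`, `Rct = φ₀r` (constant). -/

section General

variable {F E : Type} [Field F] [NumberField F] [Field E] [NumberField E] [Algebra F E] {c : E ≃ₐ[F] E}
variable [MeasurableSpace (quasiSplit F E c 2).Adelic] [BorelSpace (quasiSplit F E c 2).Adelic]

/-- **THE SIEGEL-TOP FORMULA, SHAPE-FREE**: for `T ≥ 1`, a left-`G(F)`-invariant `u`, every `y` and EVERY maximiser `γ₀` of `γ ↦ H(γy)`: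
`Λ^T u(y) = u(y) − 𝟙[T < H(γ₀y)]·u_B(γ₀y)` (above the floor only the top coset contributes ★, below it nothing does ★; `Λ^T u` is `G(F)`-invariant ★).
[cite: MoeglinWaldspurger1995, I.2.13] [cite: Garrett2018, §2.10–§2.11] -/
theorem truncation_apply_of_forall_borelHeight_le (ν : Measure ↥(adelicUnipotent F E c 2)) [ν.IsHaarMeasure] {𝓕 : Set ↥(adelicUnipotent F E c 2)}
    (h𝓕 : IsFundamentalDomain ↥(rationalUnipotent F E c 2) 𝓕 ν) {T : ℝ≥0} (hT : 1 ≤ T) {u : (quasiSplit F E c 2).Adelic → ℂ}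
    (hu : ∀ (γ : (quasiSplit F E c 2).arithmeticSubgroup) (x : (quasiSplit F E c 2).Adelic), u ((γ : (quasiSplit F E c 2).Adelic) * x) = u x)
    (y : (quasiSplit F E c 2).Adelic) {γ₀ : (quasiSplit F E c 2).arithmeticSubgroup}
    (hγ₀ : ∀ γ : (quasiSplit F E c 2).arithmeticSubgroup, borelHeight ((γ : (quasiSplit F E c 2).Adelic) * y) ≤ borelHeight ((γ₀ : (quasiSplit F E c 2).Adelic) * y)) :
    truncation ν 𝓕 T u y = u y - if T < borelHeight ((γ₀ : (quasiSplit F E c 2).Adelic) * y) then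
      borelConstantTerm ν 𝓕 u ((γ₀ : (quasiSplit F E c 2).Adelic) * y) else 0 := by
  by_cases h : T < borelHeight ((γ₀ : (quasiSplit F E c 2).Adelic) * y)
  · rw [if_pos h, ← truncation_rational_mul ν h𝓕 T hu γ₀ y, truncation_eq_self_sub_borelConstantTerm_of_rational_invariant_two ν h𝓕 hu hT h, hu]
  · rw [if_neg h, sub_zero]
    exact truncation_apply_eq_self_of_forall_borelHeight_le ν 𝓕 u fun δ => (hγ₀ δ).trans (not_lt.1 h)

omit [MeasurableSpace (quasiSplit F E c 2).Adelic] [BorelSpace (quasiSplit F E c 2).Adelic] in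
/-- The height at a maximiser IS `w(y) = ⨆_γ H(γy)` (so the indicator `𝟙[T < H(γ₀y)]` of the shape-free formula is the Siegel indicator `𝟙[T < w(y)]` of ★ part 1 §2–§3 and of `supHeight` ★).
[cite: BernsteinLapid2019, §4 (p. 10)] -/
theorem ciSup_borelHeight_eq_of_forall_le (y : (quasiSplit F E c 2).Adelic) {γ₀ : (quasiSplit F E c 2).arithmeticSubgroup}
    (hγ₀ : ∀ γ : (quasiSplit F E c 2).arithmeticSubgroup, borelHeight ((γ : (quasiSplit F E c 2).Adelic) * y) ≤ borelHeight ((γ₀ : (quasiSplit F E c 2).Adelic) * y)) :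
    (⨆ γ : (quasiSplit F E c 2).arithmeticSubgroup, borelHeight ((γ : (quasiSplit F E c 2).Adelic) * y)) = borelHeight ((γ₀ : (quasiSplit F E c 2).Adelic) * y) :=
  le_antisymm (ciSup_le hγ₀) (le_ciSup (bddAbove_range_borelHeight_arith_mul y) γ₀)

/-- **THE POINTWISE LIMIT, SHAPE-FREE, GENERAL POLE `ρ₀`**: if the continued family `Ẽ` is left-`G(F)`-invariant near `ρ₀`, `F g =ᶠ (z−ρ₀)Ẽ(z)(g)` is analytic at `ρ₀` (pole letter), and the
constant term has at most a simple pole at `ρ₀` with residue function `Rct`, `(z−ρ₀)·Ẽ(z)_B(g) → Rct(g)` (the ONE shape-free letter `hCTres`), then for every `y` and every maximiser `γ₀`: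
`(z−ρ₀)·Λ^T Ẽ(z)(y) → F y ρ₀ − 𝟙[T < H(γ₀y)]·Rct(γ₀y)` as `z → ρ₀`, `z ≠ ρ₀`. [cite: MoeglinWaldspurger1995, IV.1.11] [cite: Langlands1976, §7] -/
theorem tendsto_sub_mul_truncation_continued_of_forall_borelHeight_le (ν : Measure ↥(adelicUnipotent F E c 2)) [ν.IsHaarMeasure] {𝓕 : Set ↥(adelicUnipotent F E c 2)}
    (h𝓕 : IsFundamentalDomain ↥(rationalUnipotent F E c 2) 𝓕 ν) {T : ℝ≥0} (hT : 1 ≤ T) (ρ₀ : ℂ)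
    (Ec : ℂ → (quasiSplit F E c 2).Adelic → ℂ) {D : Set ℂ} (hD : ∀ᶠ z in 𝓝[≠] ρ₀, z ∈ D)
    (hEcinv : ∀ z ∈ D, ∀ (γ : (quasiSplit F E c 2).arithmeticSubgroup) (x : (quasiSplit F E c 2).Adelic), Ec z ((γ : (quasiSplit F E c 2).Adelic) * x) = Ec z x)
    {Rct : (quasiSplit F E c 2).Adelic → ℂ} (hCTres : ∀ g : (quasiSplit F E c 2).Adelic, Tendsto (fun z : ℂ => (z - ρ₀) * borelConstantTerm ν 𝓕 (Ec z) g) (𝓝[≠] ρ₀) (𝓝 (Rct g)))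
    (Fp : (quasiSplit F E c 2).Adelic → ℂ → ℂ) (hF : ∀ g, AnalyticAt ℂ (Fp g) ρ₀) (hFE : ∀ g, Fp g =ᶠ[𝓝[≠] ρ₀] fun z => (z - ρ₀) * Ec z g)
    (y : (quasiSplit F E c 2).Adelic) {γ₀ : (quasiSplit F E c 2).arithmeticSubgroup}
    (hγ₀ : ∀ γ : (quasiSplit F E c 2).arithmeticSubgroup, borelHeight ((γ : (quasiSplit F E c 2).Adelic) * y) ≤ borelHeight ((γ₀ : (quasiSplit F E c 2).Adelic) * y)) :
    Tendsto (fun z : ℂ => (z - ρ₀) * truncation ν 𝓕 T (Ec z) y) (𝓝[≠] ρ₀)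
      (𝓝 (Fp y ρ₀ - if T < borelHeight ((γ₀ : (quasiSplit F E c 2).Adelic) * y) then Rct ((γ₀ : (quasiSplit F E c 2).Adelic) * y) else 0)) := by
  -- the shape-free Siegel-top formula along the filter
  have heq : (fun z : ℂ => (z - ρ₀) * truncation ν 𝓕 T (Ec z) y) =ᶠ[𝓝[≠] ρ₀] fun z =>
      Fp y z - if T < borelHeight ((γ₀ : (quasiSplit F E c 2).Adelic) * y) then (z - ρ₀) * borelConstantTerm ν 𝓕 (Ec z) ((γ₀ : (quasiSplit F E c 2).Adelic) * y) else 0 := by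
    filter_upwards [hD, hFE y] with z hzD hzF
    rw [truncation_apply_of_forall_borelHeight_le ν h𝓕 hT (hEcinv z hzD) y hγ₀, hzF, mul_sub]
    congr 1
    split_ifs
    · rfl
    · rw [mul_zero]
  refine Tendsto.congr' heq.symm ?_
  have hF2 : Tendsto (Fp y) (𝓝[≠] ρ₀) (𝓝 (Fp y ρ₀)) := tendsto_nhdsWithin_of_tendsto_nhds (hF y).continuousAt.tendsto
  refine hF2.sub ?_
  split_ifs
  · exact hCTres _
  · exact tendsto_const_nhds

/-- **`Res_T =ᵐ Res Ẽ − 𝟙_{T<w₁}·Rct(top coset)`, SHAPE-FREE, GENERAL POLE `ρ₀`**: if `F_T : ℂ → L²(μ)` satisfies `F_T(z) =ᵐ Λ^T Ẽ(z)` on `D` and `(z−ρ₀)•F_T(z) → Res_T` in `L²(μ)`, then for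
`μ`-a.e. `x = [g]` and EVERY maximiser `γ₀` of `γ ↦ H(γ g̃⁻¹)`: `Res_T(x) = F g̃⁻¹ ρ₀ − 𝟙[T < w₁(x)]·Rct(γ₀ g̃⁻¹)` (`L²` limit ⟹ a.e. limit along a sequence; the pointwise limit is the
previous head; `H(γ₀ g̃⁻¹) = w₁(x)` ★). [cite: MoeglinWaldspurger1995, IV.1.11] [cite: BernsteinLapid2019, §4 p. 10] -/
theorem ae_residue_eq_residueValue_sub_of_forall_borelHeight_le (μ : Measure (quasiSplit F E c 2).automorphicQuotient)
    (ν : Measure ↥(adelicUnipotent F E c 2)) [ν.IsHaarMeasure] {𝓕 : Set ↥(adelicUnipotent F E c 2)}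
    (h𝓕 : IsFundamentalDomain ↥(rationalUnipotent F E c 2) 𝓕 ν) {T : ℝ≥0} (hT : 1 ≤ T) (ρ₀ : ℂ)
    (Ec : ℂ → (quasiSplit F E c 2).Adelic → ℂ) {D : Set ℂ} (hD : ∀ᶠ z in 𝓝[≠] ρ₀, z ∈ D)
    (hEcinv : ∀ z ∈ D, ∀ (γ : (quasiSplit F E c 2).arithmeticSubgroup) (x : (quasiSplit F E c 2).Adelic), Ec z ((γ : (quasiSplit F E c 2).Adelic) * x) = Ec z x)
    {Rct : (quasiSplit F E c 2).Adelic → ℂ} (hCTres : ∀ g : (quasiSplit F E c 2).Adelic, Tendsto (fun z : ℂ => (z - ρ₀) * borelConstantTerm ν 𝓕 (Ec z) g) (𝓝[≠] ρ₀) (𝓝 (Rct g)))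
    (Fp : (quasiSplit F E c 2).Adelic → ℂ → ℂ) (hF : ∀ g, AnalyticAt ℂ (Fp g) ρ₀) (hFE : ∀ g, Fp g =ᶠ[𝓝[≠] ρ₀] fun z => (z - ρ₀) * Ec z g)
    (Fam : ℂ → (quasiSplit F E c 2).L2 μ)
    (hFam : ∀ z ∈ D, ((Fam z : (quasiSplit F E c 2).L2 μ) : (quasiSplit F E c 2).automorphicQuotient → ℂ) =ᵐ[μ] (quasiSplit F E c 2).quotFun (truncation ν 𝓕 T (Ec z)))
    (Res : (quasiSplit F E c 2).L2 μ) (hRes : Tendsto (fun z : ℂ => (z - ρ₀) • Fam z) (𝓝[≠] ρ₀) (𝓝 Res)) :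
    ∀ᵐ x ∂μ, ∀ γ₀ : (quasiSplit F E c 2).arithmeticSubgroup,
      (∀ γ : (quasiSplit F E c 2).arithmeticSubgroup,
        borelHeight ((γ : (quasiSplit F E c 2).Adelic) * (Quotient.out (x : (quasiSplit F E c 2).Adelic ⧸ (quasiSplit F E c 2).quotientSubgroup))⁻¹) ≤
          borelHeight ((γ₀ : (quasiSplit F E c 2).Adelic) * (Quotient.out (x : (quasiSplit F E c 2).Adelic ⧸ (quasiSplit F E c 2).quotientSubgroup))⁻¹)) →
      ((Res : (quasiSplit F E c 2).L2 μ) : (quasiSplit F E c 2).automorphicQuotient → ℂ) x =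
        Fp (Quotient.out (x : (quasiSplit F E c 2).Adelic ⧸ (quasiSplit F E c 2).quotientSubgroup))⁻¹ ρ₀ -
          if T < supHeight F E c 2 x then Rct ((γ₀ : (quasiSplit F E c 2).Adelic) * (Quotient.out (x : (quasiSplit F E c 2).Adelic ⧸ (quasiSplit F E c 2).quotientSubgroup))⁻¹) else 0 := by
  -- an a.e.-convergent sequence `zₙ → ρ₀`, `zₙ ≠ ρ₀`
  have hIM := tendstoInMeasure_of_tendsto_Lp hRes
  obtain ⟨ns, hns, hae⟩ := hIM.exists_seq_tendsto_ae'
  have hnsD : ∀ᶠ n in atTop, ns n ∈ D := hns.eventually hD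
  have hrep : ∀ᵐ x ∂μ, ∀ n, ns n ∈ D → (((ns n - ρ₀) • Fam (ns n) : (quasiSplit F E c 2).L2 μ) : (quasiSplit F E c 2).automorphicQuotient → ℂ) x =
      (ns n - ρ₀) * (quasiSplit F E c 2).quotFun (truncation ν 𝓕 T (Ec (ns n))) x := by
    rw [ae_all_iff]
    intro n
    by_cases hn : ns n ∈ D
    · filter_upwards [Lp.coeFn_smul (ns n - ρ₀) (Fam (ns n)), hFam (ns n) hn] with x hx hx'
      intro _
      rw [hx, Pi.smul_apply, hx', smul_eq_mul]
    · exact ae_of_all _ fun x h => absurd h hn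
  filter_upwards [hae, hrep] with x hx hxrep γ₀ hγ₀
  set y : (quasiSplit F E c 2).Adelic := (Quotient.out (x : (quasiSplit F E c 2).Adelic ⧸ (quasiSplit F E c 2).quotientSubgroup))⁻¹ with hy
  -- the pointwise limit along the sequence
  have hpt := (tendsto_sub_mul_truncation_continued_of_forall_borelHeight_le ν h𝓕 hT ρ₀ Ec hD hEcinv hCTres Fp hF hFE y hγ₀).comp hns
  have hW : borelHeight ((γ₀ : (quasiSplit F E c 2).Adelic) * y) = supHeight F E c 2 x := by
    rw [← ciSup_borelHeight_eq_of_forall_le y hγ₀, supHeight_eq_ciSup_arithmetic]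
  rw [hW] at hpt
  have hev : (fun n => (((ns n - ρ₀) • Fam (ns n) : (quasiSplit F E c 2).L2 μ) : (quasiSplit F E c 2).automorphicQuotient → ℂ) x) =ᶠ[atTop]
      ((fun z : ℂ => (z - ρ₀) * truncation ν 𝓕 T (Ec z) y) ∘ ns) := by
    filter_upwards [hnsD] with n hn
    rw [hxrep n hn]
    rfl
  exact tendsto_nhds_unique (hx.congr' hev) hpt

end General

end Summit.HodgeConjecture.HodgeConjecture.Cruxes.H413.K2E1ContinuedEisensteinResidueShapeFreeUTwo

end
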